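import Summits.BirchSwinnertonDyer.BirchSwinnertonDyer.Theses.UniversalToricDescent
import Summits.BirchSwinnertonDyer.BirchSwinnertonDyer.Theorems.EisensteinPrimesHidaLimitFittingBoundConverse
import Summits.BirchSwinnertonDyer.Rank1Residual.X11b.BDPRouteOpenInputDegenerateFrame
import Literature.NumberTheory.EllipticCurves.CyclotomicIwasawaMainTheoremIrreducibleProofs
import HarnessLib

/-!
# NODE (D-0171) on crux stmt-BirchSwinnertonDyer-24207 `UniversalToricDescent.RationalSplitIMCInclusionAtThree`
# — idea `layer-cake-sublinear-slack` (crux-ideate seat `cruxidea-stmt-BirchSwinnertonDyer-24207-1` gen 12, 2026-08-31)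

KIND: DOOR (EQUIV) + DEPTH LEMMA (correction of the lineage's L4 `LayerwiseDepthCap`) + a quantified finite-layer
form of the trace-zero barrier (B-g12-1, docstrings only).  No summit statement and no crux is proved here; the crux
stays a displayed antecedent / consequent.  Imports: Theses / Theorems / Literature / HarnessLib only.

## The lever (pure algebra over `R₀⟦T⟧ = UnrSeries 3`, `ω_n = (1+T)^{3ⁿ} − 1`)

**D — the SLOPE-TOLERANT (sublinear-slack) layer door.**  For `g ≠ 0`, `L`, a slack function `s : ℕ → ℕ` with
`n − s n → ∞` and `3^{s n}·L ∈ (g) + (ω_n)` for all large `n`:  `∃ k, 3ᵏ·L ∈ (g)` (`k = μ(g)`).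
Proof sketch (Lean size M): `g = 3^μ·g₀` with `3 ∤ g₀`; `A := R₀⟦T⟧/(g₀)` is `3`-torsion-free (`3` is prime in
`R₀⟦T⟧`); Weierstrass preparation (Mathlib `PowerSeries.IsWeierstrassFactorization`) makes `A` free of rank
`λ = λ(g₀)` over `R₀` with `T^λ·A ⊆ 3A + T·(…)`, hence `T^{iλ} ∈ 3^i A`; `v₃ (3ⁿ choose i) = n − v₃(i)`; so
`ω_n·A ⊆ 3^{n − c(λ)}·A` with `c(λ) = ⌈log₃ λ⌉ + 2` — this is piece **DL** below — whence
`L̄ ∈ (3^{n−c}A : 3^{s n}) = 3^{n − c − s n}A` for all large `n`, `L̄ ∈ ⋂ⱼ 3ʲA = 0` (Krull, `A` Noetherian local-ish /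
`3`-adically separated), `g₀ ∣ L`, `3^μ L ∈ (g)`.

**DL — the depth lemma** (`3 ∤ g`, `g ≠ 0` ⇒ `∃ c ∀ n, ω_n ∈ (g) + (3^{n−c})`): the `(ω_n)`-filtration and the
`3`-adic filtration on `A = R₀⟦T⟧/(g₀)` are COMMENSURABLE from one side, `ω_n A ⊆ 3^{n−c}A` (the only direction D
uses; the reverse `3^{n + c'}A ⊆ ω_n A` holds iff `g₀` is prime to every `ω_n`, i.e. has no root `ζ_{3^j} − 1`, and
fails otherwise; the unconditional reverse-type fact is `(3^m, ω_m) ⊆ (3,T)^{…}`, tree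
`…LayerTower.span_pow_sup_span_omega_le_pow`).  CONSEQUENCE
(correction of L4 in `Ideas/adic-congruence-ladder.md` l.131–135, which asserts «the exponent of `R₀⟦T⟧/(F, ω_n)` is
bounded by `e_∞(F)` INDEPENDENT of `n` … any layer-wise statement mod `3^m` is vacuous beyond depth `e_∞`»): as a
statement about IDEALS this is FALSE — `F = T − 3`: `R₀⟦T⟧/(F, ω_n) ≅ R₀/(4^{3ⁿ} − 1) = R₀/3^{n+1}` (lifting the
exponent; the kernel-checked datum is `depthWitness` below), exponent `n + 1 → ∞`; in general
`e_n(F) ≥ n − c(λ)` (and `e_n(F) ≤ n + c'(F)` when `F` is prime to every `ω_n`, `= ∞` otherwise).  L4 is true only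
CHARACTER-WISE (in the maximal order `∏_{j≤n} R₀[ζ_{3^j}]`, where
`|F(ζ_{3^j} − 1)|` is bounded below for `j ≫ 0`): layers DO see depth `≍ n`; what they fail to see is decided by
the SHAPE of the carrier, not by depth (B-g12-1 below).

**TIGHTNESS of D.**  Bounded gap is not enough: `g = T − 3`, `L = 3^C·(T − 9)` satisfy `3^{n−C}·L ∈ (g) + (ω_n)`
for all `n ≥ C` (`ω_n ≡ 4^{3ⁿ} − 1 = 3^{n+1}·unit (mod g)`, `L ≡ −6·3^C`), yet `g ∤ 3ᵏL` for every `k`.  So the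
hypothesis `n − s n → ∞` of D is sharp: per-layer loss of slope `< 1` closes, slope `1` (loss `n − O(1)`) does not.

## Composition and status of the pieces (tags per D-0171)

* **D**  `SublinearSlackDoor`            [WEAKER · ATTACKABLE (M)]  — pure commutative algebra, no arithmetic.
* **DL** `LayerDepthLemma`               [WEAKER · ATTACKABLE (S/M)] — implies D with Krull + content factorisation.
* **Lay** `LayerMembershipAtThree`       [EQUIV (mod D; converse `layerMembership_of_rationalSplitIMCInclusionAtThree`
  kernel-checked) · UNDECIDED] — on the wall's binders: `∃ s, n − s n → ∞ ∧ ∀ n ≫ 0, 3^{s n}·L ∈ Ch·R₀⟦T⟧ + (ω_n)`.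
* **SLay** `SlopeLayerMembershipAtThree` [CHILD of Lay (kernel: `layerMembership_of_slope`) · EQUIV (the crux gives
  slope `0`, `slopeLayerMembership_of_rationalSplitIMCInclusionAtThree`) · UNDECIDED] — slack of slope `a/b < 1`:
  `b·s n ≤ a·n + b·C`; this is the output format of an anticyclotomic special-element tower that is TEMPERED OF
  ORDER `r = a/b < 1` with layerwise Fitting control and layer reciprocity (leaves below).
* kernel: `rationalSplitIMCInclusionAtThree_of_door_of_layerMembership : D → Lay → crux` (BY NAME), and
  `… _of_door_of_slope : D → SLay → crux`.
* `depthWitness : padicValNat 3 (4 ^ 3 ^ n − 1) = n + 1` — instrument datum refuting L4-as-ideal-statement.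

Nearest in-tree prior art and the delta.  The UNIFORM-slack door (one `μ` for all layers) is typed and proved on the
sibling route CumulativeHeegnerLeopoldt: `…CumulativeHeegnerInclusionAtThreeLayerTower.temperedHeegnerInclusionAtThree
_iff_charLayerTower`, `…LayerFittingDoor.temperedHeegnerInclusionAtThree_of_mazurTateTower` ((MT): `3^μ·L ∈ (θ_m) +
(3^m) + (ω_m)` with ONE `μ`), and ported to this frame by the 20395 card `layer-fitting-transfer` (g34), whose g39
calibration (B-g39-3) found the uniform reciprocity (δ) FALSE already in the ordinary prototype and priced the layer
route at «one factor 3 per layer».  D replaces "one μ" by "any slack of slope < 1" — the exact threshold — so the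
verdict «m-dependent loss ⇒ dead» becomes the quantitative question «is the loss slope < 1?», and DL replaces the
false depth cap L4.  Print: Mazur–Tate-type layer conjectures are stated with NO slack (C.-H. Kim, arXiv:1612.03743;
arXiv:2503.09034 Conj. 1, both DEFINITE settings at good primes); Darmon, Invent. 110 (1992) (Heegner, split
ordinary).  No slope-tolerant door found in corpus (fts + vec) or galaxy (queries in the card).

## Leaves of Lay / SLay (informal; tags)

(K_m) equivariant horizontal Heegner–Kolyvagin FITTING bound over `ℤ/3^k[G_m] ⊗ R₀` for `Sel_(∅,0)(K_m)`,
    `Fitt ∋ f(c)` for the layer carrier `c` and functionals `f` — shared with `layer-fitting-transfer` (ii)+(ii′)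
    [ATTACKABLE-by-port + Gorenstein seam: Howard 2004 H.0–H.5 at p = 3 on the surjective cell; Sakamoto 2018/2024].
(W_m) layer reciprocity at finite-order ramified `χ` (p-adic Waldspurger, Liu–Zhang–Zhang Thm 1.5.3; tree fact
    `LiuZhangZhang2018.PAdicWaldspurgerEllipticCurveAdditive` covers the unramified branch character only) [ATTACKABLE;
    typing gap: ramified finite-order `χ`].
(C_r) an anticyclotomic CARRIER OF TEMPERED ORDER r < 1 at additive 3: classes `c_m ∈ H¹(K_m, T)` in Selmer position
    with `Tr_{m/j} c_m = 3^{e(m,j)}·u·c_j`, `e(m,j) ≤ r(m−j) + C`  [IDEA-NEEDED — and BARRIER for every Heegner-fed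
    carrier, B-g12-1:]

**B-g12-1 (quantified trace-zero at finite layers = zero net depth).**  At an additive prime the vertical
distribution relation on CM points of `3`-power conductor is `U₃·y_m = Tr_{m+1/m} y_{m+1}` with `a₃ = 0` and NO lower
term (the local Euler factor is `1`; contrast `p ∤ N`: `T_p y_m = Tr y_{m+1} + y_{m−1}`), so `Tr_{m+1/m} y_{m+1} = 0`
EXACTLY and the Heegner module is `H_∞ = ⊕ⱼ O_j·y_j`, `O_j = ℤ₃[G_j]/(Φ_j)`; on it `Tr_{m/j}` is `3^{m−j}` on `⊕_{l≤j}`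
and `0` above, so EVERY family drawn from `H_∞` (Kolyvagin derivatives and old-space components included) is tempered
of order `≥ 1`.  Dually, at layer `m` an `R₀[G_m]`-linear functional `f` has `f(y_j) ∈ Ann(Φ_j) = (ω_m/Φ_j)`, whose
value at a level-`j` character has `v₃ = (m − j) + ½`, while vanishing at the levels `j+1, …, m` buys depth exactly
`m − j` at level `j` in `R₀⟦T⟧/(g₀)` (`Φ_l ≡ 3·unit` there for `l ≥ l₀(λ)`): NET `O(1)`.  Hence every certificate fed
by Heegner points of `3`-power conductor has `s_m = m + O(1)` and NO layer door — uniform (CHL (MT), g34), sublinear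
or slope-tolerant (D) — closes from it; this is B-g37-1 / B-g39-3 / L54-2 on one footing and it REPLACES L4.  The
cleanest form is the COINVARIANT TEST at the trivial character alone: an `R₀[G_m]`-linear `f` maps a `G_m`-invariant
class `y₀` into `R₀[G_m]^{G_m} = ν_m·R₀[G_m]` (augmentation `3^m`) and a trace-zero class `y_j`, `j ≥ 1`, into
`Ann(Φ_j)` (augmentation `0`), so the certificate ideal `f(H_m) + (ω_m)` has augmentation `⊆ 3^m·R₀`, while
`L(𝟙) ≠ 0` is FIXED (`r_an = 1`, BDP at the trivial character): `s_m ≥ m − v₃(L(𝟙))` (kernel anchor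
`functional_killed_of_killed` below: `φ • y = 0 ⇒ φ · f y = 0`).  A carrier passes the test iff its `G_m`-coinvariants
map to `H¹(K, T)/tors` with index `3^{e(m)}`, `e(m) ≤ r·m + C`, `r < 1` — i.e. iff it is tempered of order `< 1`.  The
ordinary case escapes because `y_j` is a unit multiple of a trace (free Heegner module); the signed case `p ∤ N,
a_p = 0` escapes because `Tr y_{m+1} = −y_{m−1}` is order `½ < 1` (and D would close there).  What (C_r) asks for is
therefore a NON-Heegner anticyclotomic carrier; candidates examined this generation and dismissed: Beilinson–Flach
classes over the CM family (live on the `𝔭`-ramified ℤ₃-extension, not on `K_∞^{ac}`, and the explicit reciprocity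
law needs `p ∤ N`: B-g10-2), Kato's classes over the semistabilising field (parity lock B-g11-1 / cubic taming g11).
-/

open scoped Classical TensorProduct

namespace Summit.BirchSwinnertonDyer.BirchSwinnertonDyer.Cruxes.RationalSplitIMCInclusionAtThree.LayerCakeSublinearSlack

open PowerSeries Literature.NumberTheory.EllipticCurves
  Summit.BirchSwinnertonDyer.Rank1Residual.X11b

/-- `ω_n = (1+T)^{3ⁿ} − 1 ∈ R₀⟦T⟧` (the layer modulus; `R₀⟦T⟧/(ω_n) = R₀[G_n]`, `γ ↦ 1 + T`). -/
noncomputable def omega (n : ℕ) : UnrSeries 3 := (1 + PowerSeries.X) ^ (3 ^ n) - 1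

/-- Layer membership with scalar slack `s` at layer `n`, relative to an ideal `I` of `R₀⟦T⟧`:
`3^s · L ∈ I + (ω_n)`. -/
def LayerMem (I : Ideal (UnrSeries 3)) (L : UnrSeries 3) (s n : ℕ) : Prop :=
  ((3 : ℕ) : UnrSeries 3) ^ s * L ∈ I ⊔ Ideal.span {omega n}

/-- **D [WEAKER · ATTACKABLE (M)]** the slope-tolerant (sublinear-slack) layer door: membership modulo `ω_n` with a
`3`-power slack `s n` such that `n − s n → ∞` forces divisibility up to `3^{μ(g)}`.  Sharp: slack `n − C` does not
suffice (`g = T − 3`, `L = 3^C(T − 9)`). [folklore ingredients: Weierstrass preparation (Mathlib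
`PowerSeries.IsWeierstrassFactorization`); Kummer `v_p (pⁿ choose i) = n − v_p i`; Krull intersection] -/
def SublinearSlackDoor : Prop :=
  ∀ (g L : UnrSeries 3) (s : ℕ → ℕ) (m₀ : ℕ), g ≠ 0 →
    Filter.Tendsto (fun n => n - s n) Filter.atTop Filter.atTop →
    (∀ n, m₀ ≤ n → LayerMem (Ideal.span {g}) L (s n) n) →
    ∃ k : ℕ, ((3 : ℕ) : UnrSeries 3) ^ k * L ∈ Ideal.span {g}

/-- **DL [WEAKER · ATTACKABLE (S/M)]** the depth lemma: for `g ≠ 0` with `3 ∤ g` (`μ(g) = 0`) the layers have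
`3`-adic depth `n − c(g)` modulo `g`: `ω_n ∈ (g) + (3^{n−c})` for every `n` (trivial for `n ≤ c`).  Corrects L4
(`LayerwiseDepthCap`), see the header and `depthWitness`. -/
def LayerDepthLemma : Prop :=
  ∀ g : UnrSeries 3, g ≠ 0 → ¬ (((3 : ℕ) : UnrSeries 3) ∣ g) →
    ∃ c : ℕ, ∀ n : ℕ, omega n ∈ Ideal.span {g} ⊔ Ideal.span {((3 : ℕ) : UnrSeries 3) ^ (n - c)}

/-- **Lay [EQUIV (mod D) · UNDECIDED]** layer membership of the BDP function in `Ch_Λ(X_(∅,0))·R₀⟦T⟧ + (ω_n)` with a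
slack of slope `< 1` (`n − s n → ∞`), on the wall's binders verbatim. -/
def LayerMembershipAtThree : Prop :=
  ∀ (W : WeierstrassCurve ℚ) [W.IsElliptic] [W.IsGloballyMinimal] (N : ℕ) [NeZero N] (K : Type) [Field K] [NumberField K] (Dt : Literature.NumberTheory.EllipticCurves.ModularForms.ModularParametrizationData W N), Summit.BirchSwinnertonDyer.Rank1Residual.Additive.ClassO6 W 3 → W.HasSurjectiveModNGaloisRep 3 → W.analyticRank = 1 → W.conductorNorm ℤ = N → Literature.NumberTheory.EllipticCurves.IsImaginaryQuadratic K → Literature.NumberTheory.EllipticCurves.SatisfiesHeegnerHypothesis N K → ∀ (κ : Literature.NumberTheory.EllipticCurves.ZpExtension K 3), κ.IsAnticyclotomic → ∀ (γ : Field.absoluteGaloisGroup K) [Fact (κ.IsTopGenerator γ)] (𝔭 : IsDedekindDomain.HeightOneSpectrum (NumberField.RingOfIntegers K)), ((3 : ℕ) : NumberField.RingOfIntegers K) ∈ 𝔭.asIdeal → 𝔭.asIdeal.ramificationIdx (NumberField.RingOfIntegers ℚ) = 1 → 𝔭.asIdeal.inertiaDeg (NumberField.RingOfIntegers ℚ)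 = 1 → ∀ (𝔭' : IsDedekindDomain.HeightOneSpectrum (NumberField.RingOfIntegers K)), ((3 : ℕ) : NumberField.RingOfIntegers K) ∈ 𝔭'.asIdeal → 𝔭' ≠ 𝔭 → ∀ (ι' : PadicAlgCl 3 ≃+* ℂ), Summit.BirchSwinnertonDyer.BirchSwinnertonDyer.Theorems.SchneiderFree.BranchInducesPrime 3 ι' 𝔭 → ∀ (ΩK : ℂ) (Ωp : ℂ_[3]) (L : Literature.NumberTheory.EllipticCurves.UnrSeries 3), ΩK ≠ 0 → Ωp ≠ 0 → Literature.NumberTheory.EllipticCurves.IsBDPLFunction ι' 𝔭 κ γ Dt.f ΩK Ωp L → ∃ (s : ℕ → ℕ) (m₀ : ℕ), Filter.Tendsto (fun n => n - s n) Filter.atTop Filter.atTop ∧ ∀ n, m₀ ≤ n → LayerMem ((Summit.BirchSwinnertonDyer.Rank1Residual.X11b.AcSelmer.XAc.charIdeal (W.baseChange K) 3 κ 𝔭' ∅ γ).map (PowerSeries.map (Summit.BirchSwinnertonDyer.Rank1Residual.X11b.Halves.toUnr 3))) L (s n) n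

/-- **SLay [CHILD of Lay · EQUIV (mod D) · UNDECIDED; leaves (K_m) ATTACKABLE-by-port, (W_m) ATTACKABLE,
(C_r) IDEA-NEEDED / BARRIER for Heegner-fed carriers (B-g12-1)]** layer membership with slack of SLOPE `a/b < 1`
(`b·s n ≤ a·n + b·C`): the output format of a tempered carrier of order `r = a/b < 1`. -/
def SlopeLayerMembershipAtThree : Prop :=
  ∀ (W : WeierstrassCurve ℚ) [W.IsElliptic] [W.IsGloballyMinimal] (N : ℕ) [NeZero N] (K : Type) [Field K] [NumberField K] (Dt : Literature.NumberTheory.EllipticCurves.ModularForms.ModularParametrizationData W N), Summit.BirchSwinnertonDyer.Rank1Residual.Additive.ClassO6 W 3 → W.HasSurjectiveModNGaloisRep 3 → W.analyticRank = 1 → W.conductorNorm ℤ = N → Literature.NumberTheory.EllipticCurves.IsImaginaryQuadratic K → Literature.NumberTheory.EllipticCurves.SatisfiesHeegnerHypothesis N K → ∀ (κ : Literature.NumberTheory.EllipticCurves.ZpExtension K 3), κ.IsAnticyclotomic → ∀ (γ : Field.absoluteGaloisGroup K) [Fact (κ.IsTopGenerator γ)] (𝔭 : IsDedekindDomain.HeightOneSpectrum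 (NumberField.RingOfIntegers K)), ((3 : ℕ) : NumberField.RingOfIntegers K) ∈ 𝔭.asIdeal → 𝔭.asIdeal.ramificationIdx (NumberField.RingOfIntegers ℚ) = 1 → 𝔭.asIdeal.inertiaDeg (NumberField.RingOfIntegers ℚ) = 1 → ∀ (𝔭' : IsDedekindDomain.HeightOneSpectrum (NumberField.RingOfIntegers K)), ((3 : ℕ) : NumberField.RingOfIntegers K) ∈ 𝔭'.asIdeal → 𝔭' ≠ 𝔭 → ∀ (ι' : PadicAlgCl 3 ≃+* ℂ), Summit.BirchSwinnertonDyer.BirchSwinnertonDyer.Theorems.SchneiderFree.BranchInducesPrime 3 ι' 𝔭 → ∀ (ΩK : ℂ) (Ωp : ℂ_[3]) (L : Literature.NumberTheory.EllipticCurves.UnrSeries 3), ΩK ≠ 0 → Ωp ≠ 0 → Literature.NumberTheory.EllipticCurves.IsBDPLFunction ι' 𝔭 κ γ Dt.f ΩK Ωp L → ∃ (s : ℕ → ℕ) (a b C : ℕ), a < b ∧ (∀ n, b * s n ≤ a * n + b * C) ∧ ∀ n, LayerMem ((Summit.BirchSwinnertonDyer.Rank1Residual.X11b.AcSelmer.XAc.charIdeal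 (W.baseChange K) 3 κ 𝔭' ∅ γ).map (PowerSeries.map (Summit.BirchSwinnertonDyer.Rank1Residual.X11b.Halves.toUnr 3))) L (s n) n

/-! ## Bridge lemmas (verbatim from the gen-3/4/5 nodes) -/

/-- The extended characteristic ideal is principal: `Ch_Λ(X)·R₀⟦T⟧ = (F)`. -/
theorem exists_map_charIdeal_eq_span {K : Type} [Field K] [NumberField K] (W : WeierstrassCurve K)
    (κ : ZpExtension K 3) (𝔭' : IsDedekindDomain.HeightOneSpectrum (NumberField.RingOfIntegers K))
    (γ : Field.absoluteGaloisGroup K) [Fact (κ.IsTopGenerator γ)] :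
    ∃ F : UnrSeries 3, (AcSelmer.XAc.charIdeal W 3 κ 𝔭' ∅ γ).map (PowerSeries.map (Halves.toUnr 3)) =
      Ideal.span {F} := by
  obtain ⟨f, hf⟩ := (charIdeal_isPrincipal_holds 3 (AcSelmer.XAc W 3 κ 𝔭' ∅ γ)).principal
  refine ⟨PowerSeries.map (Halves.toUnr 3) f, ?_⟩
  have hf' : AcSelmer.XAc.charIdeal W 3 κ 𝔭' ∅ γ = Ideal.span {f} := by
    change Literature.NumberTheory.EllipticCurves.Module.charIdeal (IwasawaAlgebra 3) (AcSelmer.XAc W 3 κ 𝔭' ∅ γ) =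
      Ideal.span {f}
    simpa [Ideal.submodule_span_eq] using hf
  rw [hf', Ideal.map_span, Set.image_singleton]

/-- The extended characteristic ideal is nonzero (`Ch_Λ ≠ ⊥` over a domain, `Λ → R₀⟦T⟧` injective). -/
theorem map_charIdeal_ne_bot {K : Type} [Field K] [NumberField K] (W : WeierstrassCurve K)
    (κ : ZpExtension K 3) (𝔭' : IsDedekindDomain.HeightOneSpectrum (NumberField.RingOfIntegers K))
    (γ : Field.absoluteGaloisGroup K) [Fact (κ.IsTopGenerator γ)] :
    (AcSelmer.XAc.charIdeal W 3 κ 𝔭' ∅ γ).map (PowerSeries.map (Halves.toUnr 3)) ≠ ⊥ := by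
  rw [Ne, Ideal.map_eq_bot_iff_of_injective map_toUnr_injective]
  exact Literature.NumberTheory.EllipticCurves.Module.charIdeal_ne_bot (IwasawaAlgebra 3) _

/-! ## Kernel-checked compositions -/

/-- **D ∧ Lay ⟹ 24207 (BY NAME).** -/
theorem rationalSplitIMCInclusionAtThree_of_door_of_layerMembership
    (hD : SublinearSlackDoor) (hLay : LayerMembershipAtThree) :
    Summit.BirchSwinnertonDyer.BirchSwinnertonDyer.Theses.UniversalToricDescent.RationalSplitIMCInclusionAtThree := by
  intro W _ _ N _ K _ _ Dt hO6 hsurj hr1 hN hK hH κ hκ γ _ 𝔭 h𝔭 he hf 𝔭' h𝔭' hne ι' hι ΩK Ωp L hΩK hΩp hL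
  obtain ⟨F, hF⟩ := exists_map_charIdeal_eq_span (W.baseChange K) κ 𝔭' γ
  have hF0 : F ≠ 0 := by
    intro h0
    apply map_charIdeal_ne_bot (W.baseChange K) κ 𝔭' γ
    rw [hF, h0, Ideal.span_singleton_eq_bot]
  obtain ⟨s, m₀, hs, hmem⟩ :=
    hLay W N K Dt hO6 hsurj hr1 hN hK hH κ hκ γ 𝔭 h𝔭 he hf 𝔭' h𝔭' hne ι' hι ΩK Ωp L hΩK hΩp hL
  have hmem' : ∀ n, m₀ ≤ n → LayerMem (Ideal.span {F}) L (s n) n := by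
    intro n hn; have h := hmem n hn; rwa [hF] at h
  obtain ⟨k, hk⟩ := hD F L s m₀ hF0 hs hmem'
  exact ⟨k, by rw [hF]; exact hk⟩

/-- Slope `a/b < 1` slack has `n − s n → ∞`. -/
theorem tendsto_sub_of_slope {s : ℕ → ℕ} {a b C : ℕ} (hab : a < b) (hs : ∀ n, b * s n ≤ a * n + b * C) :
    Filter.Tendsto (fun n => n - s n) Filter.atTop Filter.atTop := by
  rw [Filter.tendsto_atTop_atTop]
  intro M
  refine ⟨b * (C + M), fun n hn => ?_⟩
  have hb : 0 < b := by omega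
  have h1 : b * (s n + M) ≤ b * n := by
    calc b * (s n + M) = b * s n + b * M := by ring
      _ ≤ a * n + b * C + b * M := Nat.add_le_add_right (hs n) _
      _ = a * n + b * (C + M) := by ring
      _ ≤ a * n + n := Nat.add_le_add_left hn _
      _ = (a + 1) * n := by ring
      _ ≤ b * n := Nat.mul_le_mul_right n hab
  have h2 : s n + M ≤ n := Nat.le_of_mul_le_mul_left h1 hb
  show M ≤ n - s n
  omega

/-- **SLay ⟹ Lay** (the child implies the parent; kernel). -/
theorem layerMembership_of_slope (h : SlopeLayerMembershipAtThree) : LayerMembershipAtThree := by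
  intro W _ _ N _ K _ _ Dt hO6 hsurj hr1 hN hK hH κ hκ γ _ 𝔭 h𝔭 he hf 𝔭' h𝔭' hne ι' hι ΩK Ωp L hΩK hΩp hL
  obtain ⟨s, a, b, C, hab, hs, hmem⟩ :=
    h W N K Dt hO6 hsurj hr1 hN hK hH κ hκ γ 𝔭 h𝔭 he hf 𝔭' h𝔭' hne ι' hι ΩK Ωp L hΩK hΩp hL
  exact ⟨s, 0, tendsto_sub_of_slope hab hs, fun n _ => hmem n⟩

/-- **D ∧ SLay ⟹ 24207 (BY NAME).** -/
theorem rationalSplitIMCInclusionAtThree_of_door_of_slope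
    (hD : SublinearSlackDoor) (hS : SlopeLayerMembershipAtThree) :
    Summit.BirchSwinnertonDyer.BirchSwinnertonDyer.Theses.UniversalToricDescent.RationalSplitIMCInclusionAtThree :=
  rationalSplitIMCInclusionAtThree_of_door_of_layerMembership hD (layerMembership_of_slope hS)

/-- **EQUIV evidence (costume check): 24207 ⟹ SLay** with slope `0` (`s ≡ k`, `a = 0`, `b = 1`, `C = k`). -/
theorem slopeLayerMembership_of_rationalSplitIMCInclusionAtThree
    (h : Summit.BirchSwinnertonDyer.BirchSwinnertonDyer.Theses.UniversalToricDescent.RationalSplitIMCInclusionAtThree) :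
    SlopeLayerMembershipAtThree := by
  intro W _ _ N _ K _ _ Dt hO6 hsurj hr1 hN hK hH κ hκ γ _ 𝔭 h𝔭 he hf 𝔭' h𝔭' hne ι' hι ΩK Ωp L hΩK hΩp hL
  obtain ⟨k, hk⟩ := h W N K Dt hO6 hsurj hr1 hN hK hH κ hκ γ 𝔭 h𝔭 he hf 𝔭' h𝔭' hne ι' hι ΩK Ωp L hΩK hΩp hL
  refine ⟨fun _ => k, 0, 1, k, Nat.zero_lt_one, fun n => by simp, fun n => ?_⟩
  exact Ideal.mem_sup_left hk

/-- **EQUIV evidence: 24207 ⟹ Lay.** -/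
theorem layerMembership_of_rationalSplitIMCInclusionAtThree
    (h : Summit.BirchSwinnertonDyer.BirchSwinnertonDyer.Theses.UniversalToricDescent.RationalSplitIMCInclusionAtThree) :
    LayerMembershipAtThree :=
  layerMembership_of_slope (slopeLayerMembership_of_rationalSplitIMCInclusionAtThree h)

/-! ## Kernel anchor of B-g12-1 (coinvariant test) -/

/-- If `φ` kills `y` (`φ = Φ_j(γ)`, the relative norm, on a trace-zero Heegner class; or `φ ∈ I_G` on an invariant
class) then `φ` kills `f y` for every `A`-linear functional `f` — so `f y ∈ Ann_A(φ)`: for `φ = Φ_j` this is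
`(ω_m/Φ_j)`, of augmentation `0` (`j ≥ 1`) resp. `3^m` (`j = 0`, `Ann(I_G) = ν_m·A`). -/
theorem functional_killed_of_killed {A : Type*} [CommRing A] {Y : Type*} [AddCommGroup Y] [Module A Y]
    (f : Y →ₗ[A] A) {φ : A} {y : Y} (h : φ • y = 0) : φ * f y = 0 := by
  rw [← smul_eq_mul, ← map_smul, h, map_zero]

/-! ## Instrument datum (kernel): the depth of the layers is unbounded — L4 as an ideal statement is false -/

/-- `v₃(4^{3ⁿ} − 1) = n + 1`: with `F = T − 3`, `R₀⟦T⟧/(F, ω_n) ≅ R₀/(ω_n(3)) = R₀/(4^{3ⁿ} − 1) = R₀/3^{n+1}`, of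
exponent `n + 1 → ∞` (lifting the exponent, Mathlib `padicValNat.pow_sub_pow`). -/
theorem depthWitness (n : ℕ) : padicValNat 3 (4 ^ 3 ^ n - 1) = n + 1 := by
  have hodd : Odd 3 := by decide
  have h := padicValNat.pow_sub_pow (p := 3) (x := 4) (y := 1) hodd (by norm_num) (by norm_num) (by norm_num)
    (n := 3 ^ n) (pow_ne_zero n (by norm_num))
  rw [one_pow] at h
  rw [h, padicValNat.prime_pow, show (4 - 1 : ℕ) = 3 from rfl, padicValNat_self]
  ring

/-- Layer-by-layer table of the witness for `n ≤ 3` (`decide`-level sanity: `4^1−1 = 3`, `4^3 − 1 = 63 = 3²·7`,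
`4^9 − 1 = 3³·7·19·73`, `4^27 − 1 = 3⁴·…`). -/
theorem depthWitness_table :
    padicValNat 3 (4 ^ 3 ^ 0 - 1) = 1 ∧ padicValNat 3 (4 ^ 3 ^ 1 - 1) = 2 ∧
    padicValNat 3 (4 ^ 3 ^ 2 - 1) = 3 ∧ padicValNat 3 (4 ^ 3 ^ 3 - 1) = 4 :=
  ⟨depthWitness 0, depthWitness 1, depthWitness 2, depthWitness 3⟩

end Summit.BirchSwinnertonDyer.BirchSwinnertonDyer.Cruxes.RationalSplitIMCInclusionAtThree.LayerCakeSublinearSlack
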